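import Mathlib
import HarnessLib
import Summits.Parity.GeneralizedHardyLittlewood.Theses.SiegelSpectrumSplit
import Summits.Parity.GeneralizedHardyLittlewood.Theses.GhostBoundaryCarving
import Literature.NumberTheory.Sieve.PolymathBoundedGaps
import Literature.NumberTheory.Sieve.PrimeGapLimitPointsOfGHL

/-!
# Route `GhostBoundaryCarving`: the leaf-level necessity theorem `FixedLower → DHL[k, k]` (hand for item `TwoOfThree`)

The one piece of new kernel mathematics in the decomp-parity node G1.2.L «GhostBoundaryCarving»
(lens-6 g4; critic CLEARED HOME/STATUS.md l.200, CRITIC-LEDGER row 44, precision P1: "the staffable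
work is a HAND landing `weakDHL_of_fixedLower` + `frequently_forall_prime_of_linear_lower` under
Theorems/"; the born item text of `TwoOfThree` = stmt-Parity-29350 repeats the request), ported
verbatim from the lens kernel file `HOME/decomp-parity-lens-6/g4/GhostBoundaryCarving.lean` §2–§4
(sha16 cee3497b238989ba at node time) onto the BORN decls:

* `frequently_forall_prime_of_linear_lower`: a LINEAR lower bound `∑_{n ≤ N} ∏ⱼ Λ(n + tⱼ) ≥ cN`
  (all large `N`) forces all `n + tⱼ` to be prime for infinitely many `n` (Chebyshev:
  `ψ − θ ≤ 2√x log x`);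
* `weakDHL_of_fixedLower`: the record leaf `SiegelSpectrumSplit.FixedLower` (stmt-Parity-26863, the
  fixed-pattern lower half of Green–Tao's Conjecture 1.2) implies `DHL[k, k]` for every `k` (apply it
  at `d = 1` to the shift system of a positive translate of the tuple on `K = [1, N]`, via the
  `Gallagher.*_shiftSystem` dictionary of `PrimeGapLimitPointsOfGHL` and `𝔖 > 0 ⟺ admissible`);
* `twoOfThree_of_fixedLower`: hence `FixedLower → TwoOfThree` (`DHL[3,3] → DHL[3,2]`), the
  necessity of the route's credited piece from the leaf it carves; with `pairLift_iff`
  (`PairLift ↔ (TwoOfThree → FixedLower)`, `Iff.rfl` on the born texts) this gives the node's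
  exactness `fixedLower_iff_pieces : FixedLower ↔ TwoOfThree ∧ PairLift` in the tree.

Helper file `--supports stmt-Parity-29350` (it closes no item: `TwoOfThree` itself is GEH-class,
zone II).  0 sorry · standard axioms only.
-/

open scoped BigOperators ArithmeticFunction.vonMangoldt Chebyshev
open Finset Filter Literature.NumberTheory.Sieve

namespace Summit.Parity.GeneralizedHardyLittlewood.Theses.GhostBoundaryCarving

open Summit.Parity.GeneralizedHardyLittlewood.Theses.SiegelSpectrumSplit (FixedLower)

/-! ## §2 The new kernel theorem: `FixedLower → DHL[k, k]` for every `k` -/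

/-- `[1, N] ⊂ ℝ¹` is convex (the tree's lemma is private; re-proved). [folklore] -/
private theorem convex_natBox' (N : ℕ) : Convex ℝ (Gallagher.natBox N) := by
  have : Gallagher.natBox N = (fun x : Fin 1 → ℝ => x 0) ⁻¹' Set.Icc (1 : ℝ) N := by
    ext x; simp [Gallagher.natBox, Set.mem_Icc]
  rw [this]
  exact (convex_Icc _ _).linear_preimage (LinearMap.proj 0)

/-- `[1, N] ⊆ [−N, N]` (the tree's lemma is private; re-proved). [folklore] -/
private theorem natBox_subset_realBox' (N : ℕ) : Gallagher.natBox N ⊆ realBox 1 N := by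
  intro x hx
  simp only [Gallagher.natBox, Set.mem_setOf_eq] at hx
  simp only [realBox, Set.mem_Icc]
  constructor <;> intro j <;> rw [Fin.fin_one_eq_zero j]
  · have : (0 : ℝ) ≤ N := Nat.cast_nonneg N
    linarith [hx.1]
  · exact hx.2

/-- **A linear lower bound for `∑_{n ≤ N} ∏ⱼ Λ(n + tⱼ)` forces all `n + tⱼ` to be prime infinitely
often.**  If only finitely many `n` have every `n + tⱼ` prime, then for large `n` some factor sits on a
non-prime, so `∏ⱼ Λ(n+tⱼ) ≤ (log X)^{k-1} ∑ⱼ Λ(n+tⱼ)·[n+tⱼ not prime]`, and summing,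
`∑ ≤ n₀ (log X)^k + k (log X)^{k-1} (ψ(X) − θ(X)) ≪ √X (log X)^{k+1} = o(N)` by Chebyshev
(`Chebyshev.psi_sub_theta_le`), contradicting `∑ ≥ cN`. [folklore] -/
theorem frequently_forall_prime_of_linear_lower {k : ℕ} (t : Fin k → ℕ) {c : ℝ} (hc : 0 < c)
    (hlb : ∃ N₁ : ℕ, ∀ N : ℕ, N₁ ≤ N → c * (N : ℝ) ≤ ∑ n ∈ Icc 1 N, ∏ j, (Λ (n + t j) : ℝ)) :
    ∃ᶠ n : ℕ in atTop, ∀ j, (n + t j).Prime := by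
  by_contra hcon
  rw [Filter.not_frequently, Filter.eventually_atTop] at hcon
  obtain ⟨n₀, hn₀⟩ := hcon
  obtain ⟨N₁, hN₁⟩ := hlb
  cases k with
  | zero => exact (hn₀ n₀ le_rfl) fun j => j.elim0
  | succ k =>
  obtain ⟨T, hT⟩ : ∃ T : ℕ, ∀ j, t j ≤ T :=
    ⟨∑ j, t j, fun j => Finset.single_le_sum (fun i _ => Nat.zero_le (t i)) (Finset.mem_univ j)⟩
  have hΛ0 : ∀ (n : ℕ) (j : Fin (k + 1)), 0 ≤ (Λ (n + t j) : ℝ) := fun n j =>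
    ArithmeticFunction.vonMangoldt_nonneg
  -- the scale exponent `E = 2(k+3)` and the constants
  obtain ⟨E, hE⟩ : ∃ E : ℝ, E = (((k + 3) * 2 : ℕ) : ℝ) := ⟨_, rfl⟩
  have hE0 : 0 < E := by rw [hE]; positivity
  obtain ⟨D, hD⟩ : ∃ D : ℝ, D = ((n₀ : ℝ) + 2 * (k + 1)) * E ^ (k + 1) := ⟨_, rfl⟩
  have hD0 : 0 ≤ D := by rw [hD]; positivity
  obtain ⟨z₀, hz₀⟩ : ∃ z₀ : ℝ, z₀ = (D + c * T) / c + 1 := ⟨_, rfl⟩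
  have hcz₀ : c * z₀ = D + c * T + c := by rw [hz₀]; field_simp
  have hz₀1 : 1 ≤ z₀ := by
    have : 0 ≤ (D + c * T) / c := by positivity
    linarith
  have hz₀0 : 0 ≤ z₀ := by linarith
  -- the scale `N`
  obtain ⟨N, hNN₁, hNn₀, hNz₀⟩ : ∃ N : ℕ, N₁ ≤ N ∧ n₀ ≤ N ∧ z₀ ^ ((k + 3) * 2) ≤ (N : ℝ) := by
    refine ⟨max N₁ (max n₀ ⌈z₀ ^ ((k + 3) * 2)⌉₊), le_max_left _ _,
      le_trans (le_max_left _ _) (le_max_right _ _), le_trans (Nat.le_ceil _) ?_⟩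
    exact_mod_cast le_trans (le_max_right _ _) (le_max_right _ _)
  obtain ⟨x, hx⟩ : ∃ x : ℝ, x = ((N + T : ℕ) : ℝ) := ⟨_, rfl⟩
  have hxNT : x = (N : ℝ) + T := by rw [hx]; push_cast; ring
  have hx1 : 1 ≤ x := by
    have h1 : (1 : ℝ) ≤ z₀ ^ ((k + 3) * 2) := one_le_pow₀ hz₀1
    have h2 : (0 : ℝ) ≤ T := Nat.cast_nonneg T
    linarith
  have hx0 : 0 < x := by linarith
  -- `z = x^{1/E}`, so `x = z^{2(k+3)}`, `√x = z^{k+3}`, `log x ≤ E z`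
  obtain ⟨z, hz⟩ : ∃ z : ℝ, z = x ^ (1 / E) := ⟨_, rfl⟩
  have hzpos : 0 < z := by rw [hz]; exact Real.rpow_pos_of_pos hx0 _
  have hzE : z ^ ((k + 3) * 2) = x := by
    rw [hz, ← Real.rpow_natCast, ← Real.rpow_mul hx0.le, ← hE, one_div_mul_cancel hE0.ne',
      Real.rpow_one]
  have hz₀z : z₀ ≤ z := by
    have h1 : z₀ = (z₀ ^ ((k + 3) * 2)) ^ (1 / E) := by
      rw [← Real.rpow_natCast, ← Real.rpow_mul hz₀0, ← hE, mul_one_div_cancel hE0.ne',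
        Real.rpow_one]
    rw [h1, hz]
    refine Real.rpow_le_rpow (pow_nonneg hz₀0 _) (hNz₀.trans ?_) (div_nonneg zero_le_one hE0.le)
    rw [hxNT]; linarith [(Nat.cast_nonneg T : (0 : ℝ) ≤ T)]
  have hz1 : 1 ≤ z := hz₀1.trans hz₀z
  have hlogx : Real.log x ≤ E * z := by
    have h1 : Real.log x = E * Real.log z := by
      rw [hz, Real.log_rpow hx0, ← mul_assoc, mul_one_div_cancel hE0.ne', one_mul]
    rw [h1]
    exact mul_le_mul_of_nonneg_left ((Real.log_le_sub_one_of_pos hzpos).trans (by linarith)) hE0.le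
  have hlog0 : 0 ≤ Real.log x := Real.log_nonneg hx1
  have hsqrt : Real.sqrt x = z ^ (k + 3) := by
    rw [← hzE, pow_mul, Real.sqrt_sq (pow_nonneg hzpos.le _)]
  -- pointwise: every factor is at most `log x`
  have hΛle : ∀ n ∈ Icc 1 N, ∀ j : Fin (k + 1), (Λ (n + t j) : ℝ) ≤ Real.log x := by
    intro n hn j
    have hnN : n ≤ N := (Finset.mem_Icc.mp hn).2
    have hn1 : 1 ≤ n := (Finset.mem_Icc.mp hn).1
    refine ArithmeticFunction.vonMangoldt_le_log.trans (Real.log_le_log ?_ ?_)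
    · exact_mod_cast (show 0 < n + t j by omega)
    · rw [hx]; exact_mod_cast (show n + t j ≤ N + T from Nat.add_le_add hnN (hT j))
  -- the non-prime part of the factors
  obtain ⟨f, hf⟩ : ∃ f : ℕ → Fin (k + 1) → ℝ,
      f = fun n j => if (n + t j).Prime then 0 else (Λ (n + t j) : ℝ) := ⟨_, rfl⟩
  have hf0 : ∀ n j, 0 ≤ f n j := by
    intro n j; rw [hf]; dsimp only; split_ifs
    · exact le_rfl
    · exact hΛ0 n j
  -- pointwise bound for the product
  have hpt : ∀ n ∈ Icc 1 N, ∏ j, (Λ (n + t j) : ℝ) ≤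
      Real.log x ^ (k + 1) * (if n < n₀ then (1 : ℝ) else 0) + Real.log x ^ k * ∑ j, f n j := by
    intro n hn
    have hS0 : 0 ≤ ∑ j, f n j := Finset.sum_nonneg fun j _ => hf0 n j
    by_cases hlt : n < n₀
    · rw [if_pos hlt, mul_one]
      have h1 : ∏ j, (Λ (n + t j) : ℝ) ≤ Real.log x ^ (k + 1) :=
        calc ∏ j, (Λ (n + t j) : ℝ) ≤ ∏ _j : Fin (k + 1), Real.log x :=
              Finset.prod_le_prod (fun j _ => hΛ0 n j) fun j _ => hΛle n hn j
          _ = Real.log x ^ (k + 1) := by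
              rw [Finset.prod_const, Finset.card_univ, Fintype.card_fin]
      linarith [mul_nonneg (pow_nonneg hlog0 k) hS0]
    · rw [if_neg hlt, mul_zero, zero_add]
      obtain ⟨j₀, hj₀⟩ := not_forall.mp (hn₀ n (not_lt.mp hlt))
      rw [← Finset.mul_prod_erase Finset.univ (fun j => (Λ (n + t j) : ℝ)) (Finset.mem_univ j₀)]
      have hrest : ∏ j ∈ Finset.univ.erase j₀, (Λ (n + t j) : ℝ) ≤ Real.log x ^ k :=
        calc ∏ j ∈ Finset.univ.erase j₀, (Λ (n + t j) : ℝ)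
            ≤ ∏ _j ∈ Finset.univ.erase j₀, Real.log x :=
              Finset.prod_le_prod (fun j _ => hΛ0 n j) fun j _ => hΛle n hn j
          _ = Real.log x ^ k := by
              rw [Finset.prod_const, Finset.card_erase_of_mem (Finset.mem_univ j₀), Finset.card_univ,
                Fintype.card_fin, Nat.add_sub_cancel]
      have hsingle : (Λ (n + t j₀) : ℝ) ≤ ∑ j, f n j := by
        have h1 : f n j₀ = Λ (n + t j₀) := by rw [hf]; dsimp only; rw [if_neg hj₀]
        rw [← h1]
        exact Finset.single_le_sum (fun j _ => hf0 n j) (Finset.mem_univ j₀)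
      calc (Λ (n + t j₀) : ℝ) * ∏ j ∈ Finset.univ.erase j₀, (Λ (n + t j) : ℝ)
          ≤ (∑ j, f n j) * Real.log x ^ k :=
            mul_le_mul hsingle hrest (Finset.prod_nonneg fun j _ => hΛ0 n j) hS0
        _ = Real.log x ^ k * ∑ j, f n j := mul_comm _ _
  -- each shifted non-prime sum is at most `ψ(x) − θ(x) ≤ 2 √x log x`
  have hshift : ∀ j : Fin (k + 1), ∑ n ∈ Icc 1 N, f n j ≤ 2 * Real.sqrt x * Real.log x := by
    intro j
    calc ∑ n ∈ Icc 1 N, f n j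
        = ∑ m ∈ Icc (1 + t j) (N + t j), (if m.Prime then 0 else (Λ m : ℝ)) := by
          rw [hf]; dsimp only
          rw [← Finset.map_add_right_Icc, Finset.sum_map]; rfl
      _ ≤ ∑ m ∈ Ioc 0 (N + T), (if m.Prime then 0 else (Λ m : ℝ)) := by
          refine Finset.sum_le_sum_of_subset_of_nonneg (fun m hm => ?_) fun m _ _ => ?_
          · have := hT j
            simp only [Finset.mem_Icc, Finset.mem_Ioc] at hm ⊢; omega
          · split_ifs
            · exact le_rfl
            · exact ArithmeticFunction.vonMangoldt_nonneg
      _ = ∑ m ∈ Ioc 0 ⌊x⌋₊ with ¬ m.Prime, (Λ m : ℝ) := by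
          rw [hx, Nat.floor_natCast, Finset.sum_filter]
          refine Finset.sum_congr rfl fun m _ => ?_
          by_cases hm : m.Prime <;> simp [hm]
      _ = ψ x - θ x := (Chebyshev.psi_sub_theta_eq_sum_not_prime x).symm
      _ ≤ 2 * Real.sqrt x * Real.log x := Chebyshev.psi_sub_theta_le hx1
  -- summing the pointwise bound
  have hsum : ∑ n ∈ Icc 1 N, ∏ j, (Λ (n + t j) : ℝ) ≤
      Real.log x ^ (k + 1) * n₀ + Real.log x ^ k * ((k + 1) * (2 * Real.sqrt x * Real.log x)) := by
    refine (Finset.sum_le_sum hpt).trans ?_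
    rw [Finset.sum_add_distrib, ← Finset.mul_sum, ← Finset.mul_sum]
    have h1 : ∑ n ∈ Icc 1 N, (if n < n₀ then (1 : ℝ) else 0) ≤ n₀ := by
      rw [Finset.sum_boole]
      have : #{n ∈ Icc 1 N | n < n₀} ≤ n₀ :=
        (Finset.card_le_card (fun n hn => by
          simp only [Finset.mem_filter, Finset.mem_Icc, Finset.mem_range] at hn ⊢; omega)).trans
          (Finset.card_range n₀).le
      exact_mod_cast this
    have h2 : ∑ n ∈ Icc 1 N, ∑ j, f n j ≤ (k + 1) * (2 * Real.sqrt x * Real.log x) := by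
      rw [Finset.sum_comm]
      calc ∑ j, ∑ n ∈ Icc 1 N, f n j ≤ ∑ _j : Fin (k + 1), 2 * Real.sqrt x * Real.log x :=
            Finset.sum_le_sum fun j _ => hshift j
        _ = (k + 1) * (2 * Real.sqrt x * Real.log x) := by
            rw [Finset.sum_const, Finset.card_univ, Fintype.card_fin, nsmul_eq_mul]; push_cast; ring
    exact add_le_add (mul_le_mul_of_nonneg_left h1 (pow_nonneg hlog0 _))
      (mul_le_mul_of_nonneg_left h2 (pow_nonneg hlog0 _))
  -- in powers of `z`: `∑ ≤ D z^{2k+4}`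
  have hup : ∑ n ∈ Icc 1 N, ∏ j, (Λ (n + t j) : ℝ) ≤ D * z ^ (2 * k + 4) := by
    refine hsum.trans ?_
    have hA : Real.log x ^ (k + 1) * n₀ + Real.log x ^ k * ((k + 1) * (2 * Real.sqrt x * Real.log x))
        = ((n₀ : ℝ) + 2 * (k + 1) * Real.sqrt x) * Real.log x ^ (k + 1) := by ring
    have hs1 : 1 ≤ Real.sqrt x := by simpa using Real.sqrt_le_sqrt hx1
    have hB : (n₀ : ℝ) + 2 * (k + 1) * Real.sqrt x ≤ ((n₀ : ℝ) + 2 * (k + 1)) * Real.sqrt x := by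
      nlinarith [(Nat.cast_nonneg n₀ : (0 : ℝ) ≤ n₀)]
    have hC : Real.log x ^ (k + 1) ≤ E ^ (k + 1) * z ^ (k + 1) := by
      rw [← mul_pow]; exact pow_le_pow_left₀ hlog0 hlogx _
    calc _ = ((n₀ : ℝ) + 2 * (k + 1) * Real.sqrt x) * Real.log x ^ (k + 1) := hA
      _ ≤ (((n₀ : ℝ) + 2 * (k + 1)) * Real.sqrt x) * (E ^ (k + 1) * z ^ (k + 1)) :=
          mul_le_mul hB hC (pow_nonneg hlog0 _) (by positivity)
      _ = D * z ^ (2 * k + 4) := by rw [hsqrt, hD]; ring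
  -- the lower bound at scale `N`, and the contradiction
  have hlow : c * (N : ℝ) ≤ ∑ n ∈ Icc 1 N, ∏ j, (Λ (n + t j) : ℝ) := hN₁ N hNN₁
  have hzpow1 : 1 ≤ z ^ (2 * k + 4) := one_le_pow₀ hz1
  have hxz : x = z ^ 2 * z ^ (2 * k + 4) := by rw [← hzE]; ring
  have hzz : z ≤ z ^ 2 := by nlinarith
  have key : D * z ^ (2 * k + 4) + c * T + c ≤ c * x := by
    have h1 : c * z₀ * z ^ (2 * k + 4) ≤ c * z ^ 2 * z ^ (2 * k + 4) :=
      mul_le_mul_of_nonneg_right (mul_le_mul_of_nonneg_left (hz₀z.trans hzz) hc.le)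
        (pow_nonneg hzpos.le _)
    rw [hcz₀] at h1
    have h2 : (c * T + c) * 1 ≤ (c * T + c) * z ^ (2 * k + 4) :=
      mul_le_mul_of_nonneg_left hzpow1 (by positivity)
    rw [hxz]; nlinarith [h1, h2, hD0]
  have hcN : c * (N : ℝ) = c * x - c * T := by rw [hxNT]; ring
  linarith [hlow, hup, key, hcN]

/-- **The fixed-pattern lower half implies `DHL[k, k]` for every `k`** (every admissible `k`-tuple is a
prime `k`-tuple infinitely often): apply `FixedLower` at `d = 1` to the shift system of a positive
translate of the tuple on `K = [1, N]` (dictionary `Gallagher.vonMangoldtSum_shiftSystem`,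
`archFactor_shiftSystem`, `singularProduct_shiftSystem`; `𝔖 > 0` by admissibility,
`singularSeries_pos_iff_holds`), get `∑_{n ≤ N} ∏ Λ(n + tⱼ) ≥ (𝔖/4) N`, and conclude with
`frequently_forall_prime_of_linear_lower`. [cite: GreenTao2010, Conj. 1.2 and (1.2)–(1.7)] -/
theorem weakDHL_of_fixedLower (hFL : FixedLower) (k : ℕ) : WeakDicksonHardyLittlewood k k := by
  classical
  intro H hH hk
  subst hk
  rcases Nat.eq_zero_or_pos #H with h0 | hpos
  · exact Filter.Frequently.of_forall fun n => by rw [h0]; exact Nat.zero_le _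
  -- a positive translate of `H`, indexed by `Fin #H`
  set T₀ : ℕ := H.sup Int.natAbs with hT₀
  have habs : ∀ h ∈ H, h.natAbs ≤ T₀ := fun h hh => Finset.le_sup (f := Int.natAbs) hh
  set e : Fin #H ≃ H := H.equivFin.symm with he
  obtain ⟨t, ht⟩ : ∃ t : Fin #H → ℕ, ∀ j, (t j : ℤ) = ((e j : H) : ℤ) + T₀ + 1 := by
    refine ⟨fun j => (((e j : H) : ℤ) + T₀ + 1).toNat, fun j => Int.toNat_of_nonneg ?_⟩
    have h1 := habs _ (e j).2
    omega
  have hinj : Function.Injective t := by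
    intro i j hij
    have h1 : (t i : ℤ) = t j := by rw [hij]
    rw [ht, ht] at h1
    have h2 : ((e i : H) : ℤ) = (e j : H) := by linarith
    exact e.injective (Subtype.ext h2)
  have hinjZ : Function.Injective fun j => (t j : ℤ) := Nat.cast_injective.comp hinj
  -- the translate is admissible, so its singular series is positive
  have hadm : IsAdmissibleTuple (Gallagher.tupleSet t) := by
    intro p hp
    refine lt_of_le_of_lt ?_ (hH p hp)
    unfold tupleResidueCount Gallagher.tupleSet
    rw [Finset.image_image]
    calc ((univ : Finset (Fin #H)).image ((fun h : ℤ => (h : ZMod p)) ∘ fun j => (t j : ℤ))).card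
        ≤ ((H.image fun h : ℤ => (h : ZMod p)).image fun r => r + ((T₀ + 1 : ℕ) : ZMod p)).card := by
          refine Finset.card_le_card fun r hr => ?_
          obtain ⟨j, -, rfl⟩ := Finset.mem_image.mp hr
          refine Finset.mem_image.mpr ⟨(((e j : H) : ℤ) : ZMod p),
            Finset.mem_image.mpr ⟨((e j : H) : ℤ), (e j).2, rfl⟩, ?_⟩
          simp only [Function.comp_apply, ht j]
          push_cast; ring
      _ = (H.image fun h : ℤ => (h : ZMod p)).card :=
          Finset.card_image_of_injective _ (add_left_injective _)
  have hS : 0 < singularSeries (Gallagher.tupleSet t) := (singularSeries_pos_iff_holds _).mpr hadm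
  -- `FixedLower` for the shift system on `[1, N]`
  obtain ⟨N₀, hN₀⟩ := hFL 1 #H le_rfl hpos (Gallagher.shiftSystem fun j => (t j : ℤ))
    (Gallagher.isNondegenerateSystem_shiftSystem hinjZ) (singularSeries (Gallagher.tupleSet t) / 4)
    (div_pos hS four_pos)
  have hlb : ∃ N₁ : ℕ, ∀ N : ℕ, N₁ ≤ N → singularSeries (Gallagher.tupleSet t) / 4 * (N : ℝ) ≤
      ∑ n ∈ Icc 1 N, ∏ j, (Λ (n + t j) : ℝ) := by
    refine ⟨max N₀ 2, fun N hN => ?_⟩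
    have hN0 : N₀ ≤ N := le_trans (le_max_left _ _) hN
    have hN2' : 2 ≤ N := le_trans (le_max_right _ _) hN
    have hN2 : (2 : ℝ) ≤ N := by exact_mod_cast hN2'
    have h := hN₀ N hN0 (Gallagher.natBox N) (convex_natBox' N) (natBox_subset_realBox' N)
    rw [Gallagher.vonMangoldtSum_shiftSystem, Gallagher.archFactor_shiftSystem t (by omega),
      Gallagher.singularProduct_shiftSystem hinj, pow_one] at h
    nlinarith [mul_nonneg (sub_nonneg.mpr hN2) hS.le, h]
  have hfreq := frequently_forall_prime_of_linear_lower t (div_pos hS four_pos) hlb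
  -- back to `H`: `n + tⱼ = (n + T₀ + 1) + hⱼ`
  rw [Filter.frequently_atTop] at hfreq ⊢
  intro a
  obtain ⟨n, hn, hprime⟩ := hfreq a
  refine ⟨n + T₀ + 1, by omega, ?_⟩
  rw [Finset.filter_true_of_mem]
  intro h hh
  obtain ⟨j, hj⟩ : ∃ j, ((e j : H) : ℤ) = h := ⟨e.symm ⟨h, hh⟩, by simp⟩
  have h1 : ((n + T₀ + 1 : ℕ) : ℤ) + h = ((n + t j : ℕ) : ℤ) := by
    push_cast; rw [ht j, ← hj]; ring
  rw [h1, Int.toNat_natCast]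
  exact ⟨by exact_mod_cast (hprime j).pos, hprime j⟩

/-! ## §3 Necessity of the credited piece from the leaf, and the node's exactness on the born decls -/

/-- **Leaf-level necessity**: `FixedLower → TwoOfThree` (`DHL[3,3] → DHL[3,2]`). [this node] -/
theorem twoOfThree_of_fixedLower (h : FixedLower) : TwoOfThree :=
  (weakDHL_of_fixedLower h 3).mono (by norm_num)

/-- The born residual `PairLift` (stmt-Parity-29351) is literally `TwoOfThree → FixedLower`
(the gate inlined the record leaf's text). [this node] -/
theorem pairLift_iff : PairLift ↔ (TwoOfThree → FixedLower) := Iff.rfl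

/-- `PairLift` is necessary (costume branch: it holds whenever the leaf does). [this node] -/
theorem pairLift_of_fixedLower (h : FixedLower) : PairLift := fun _ => h

/-- **Exact carving of the record leaf** `FixedLower` (stmt-Parity-26863) by the two born cruxes of
route-Parity-GhostBoundaryCarving: `FixedLower ↔ TwoOfThree ∧ PairLift`. [this node] -/
theorem fixedLower_iff_pieces : FixedLower ↔ TwoOfThree ∧ PairLift :=
  ⟨fun h => ⟨twoOfThree_of_fixedLower h, pairLift_of_fixedLower h⟩, fun h => h.2 h.1⟩

end Summit.Parity.GeneralizedHardyLittlewood.Theses.GhostBoundaryCarving
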